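import Summits.BirchSwinnertonDyer.BirchSwinnertonDyer.Theorems.ResidualThetaTransportAtTwoHeckeThetaPartnerAdicAtTwoThetaLinesSlash
import Mathlib.NumberTheory.ModularForms.SlashActions
import Mathlib.LinearAlgebra.Matrix.FixedDetMatrices
import HarnessLib

/-!
# The span of the gradient theta nulls on rational lines is stable under `SL₂(ℤ)` in weight two
# (toward K0⁺, stmt-20690)

Route `ResidualThetaTransportAtTwo`, crux K0⁺ `HeckeThetaPartnerAdicAtTwo` (stmt-BirchSwinnertonDyer-20690),
line "Hecke theta series from the genus-two Riemann theta function".  THEOREMS ONLY.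

Let `𝒮` be the set of functions `τ ↦ ∇_u ϑ[a; b](0, τ·P)` on `ℍ` (`P ∈ Sym₂(ℚ)` positive definite,
`a, b ∈ ℚ²`, `u ∈ ℂ²`) and `V = span_ℂ 𝒮`.  Then `V ∣[2] γ ⊆ V` for every `γ ∈ SL₂(ℤ)`
(`slash_mem_span`): for `T^j` by level raising and the integral shift `(1 S; 0 1)`
(`ThetaLines`), for `S` by the inversion law (`ThetaLinesSlash.fderiv_line_inv`), and `SL₂(ℤ)` is
generated by `S, T`.  Every element of `V` is holomorphic on `ℍ` and tends to `0` at `i∞`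
(`mdifferentiable_of_mem_span`, `isZeroAtImInfty_of_mem_span`), hence a weight-two function in `V`
invariant under `Γ₀(N)` is a cusp form.

BSD is not proved by this file.
-/

set_option autoImplicit false
set_option linter.dupNamespace false

noncomputable section

open scoped Real MatrixGroups UpperHalfPlane Topology Manifold ModularForm
open Matrix Complex Filter

namespace Summit.BirchSwinnertonDyer.BirchSwinnertonDyer.Theorems.HeckeTheta

open Literature.Analysis.SpecialFunctions
open Literature.NumberTheory.ModularForms.BinaryTheta
open Literature.NumberTheory.Automorphic (siegelUpperHalfSpace mem_siegelUpperHalfSpace_iff)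

/-! ### Common denominators -/

/-- A rational symmetric `2 × 2` matrix is `N⁻¹ Z` with `Z` integral symmetric, `N ≥ 1`. -/
theorem exists_intMatrix_eq_smul (P : Matrix (Fin 2) (Fin 2) ℚ) (hPs : P.IsSymm) :
    ∃ (N : ℕ) (Z : Matrix (Fin 2) (Fin 2) ℤ), 0 < N ∧ Z.IsSymm ∧
      Z.map (Int.cast : ℤ → ℚ) = (N : ℚ) • P := by
  have h10 : P 1 0 = P 0 1 := hPs.apply 0 1
  set N : ℕ := (P 0 0).den * (P 0 1).den * (P 1 1).den with hN
  refine ⟨N, !![(P 0 0).num * ((P 0 1).den * (P 1 1).den), (P 0 1).num * ((P 0 0).den * (P 1 1).den);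
    (P 0 1).num * ((P 0 0).den * (P 1 1).den), (P 1 1).num * ((P 0 0).den * (P 0 1).den)],
    by positivity, ?_, ?_⟩
  · ext i j; fin_cases i <;> fin_cases j <;> rfl
  · ext i j
    fin_cases i <;> fin_cases j <;>
      simp only [Matrix.map_apply, Matrix.of_apply, Matrix.cons_val', Matrix.cons_val_zero,
        Matrix.cons_val_one, Matrix.empty_val', Matrix.cons_val_fin_one, Matrix.smul_apply,
        smul_eq_mul, hN, Fin.zero_eta, Fin.mk_one, Fin.isValue, h10] <;>
      push_cast <;>
      [rw [← Rat.mul_den_eq_num (P 0 0)]; rw [← Rat.mul_den_eq_num (P 0 1)];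
        rw [← Rat.mul_den_eq_num (P 0 1)]; rw [← Rat.mul_den_eq_num (P 1 1)]] <;>
      ring

/-! ### The inversion `S` -/

/-- **`𝒮 ∣[2] S ⊆ span 𝒮`**: `(∇_u ϑ[a;b](0, ·P) ∣₂ S)(τ) = Λ ∇_{P⁻¹u} ϑ[b; -a](0, τ·P⁻¹)`. -/
theorem slash_S_mem_span {P : Matrix (Fin 2) (Fin 2) ℚ} (hPs : P.IsSymm)
    (hPpos : (P.map (Rat.cast : ℚ → ℝ)).PosDef) (a b : Fin 2 → ℚ) (u : Fin 2 → ℂ) :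
    ((fun τ : ℍ => fderiv ℂ (riemannThetaChar (fun i => (a i : ℂ)) (fun i => (b i : ℂ))
        ((τ : ℂ) • P.map (Rat.cast : ℚ → ℂ))) 0 u) ∣[(2 : ℤ)] ModularGroup.S) ∈
      Submodule.span ℂ {F : ℍ → ℂ | ∃ (P : Matrix (Fin 2) (Fin 2) ℚ), P.IsSymm ∧
        (P.map (Rat.cast : ℚ → ℝ)).PosDef ∧ ∃ (a b : Fin 2 → ℚ) (u : Fin 2 → ℂ), F = fun τ : ℍ =>
          fderiv ℂ (riemannThetaChar (fun i => (a i : ℂ)) (fun i => (b i : ℂ))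
            ((τ : ℂ) • P.map (Rat.cast : ℚ → ℂ))) 0 u} := by
  -- the inverse matrix
  have hdet : P.det ≠ 0 := by
    have h := hPpos.det_pos
    rw [← Rat.cast_det] at h
    exact_mod_cast h.ne'
  have hinvmul : P⁻¹ * P = 1 := Matrix.nonsing_inv_mul _ (isUnit_iff_ne_zero.mpr hdet)
  have hmapinv : (P⁻¹).map (Rat.cast : ℚ → ℝ) = (P.map (Rat.cast : ℚ → ℝ))⁻¹ := by
    symm
    refine Matrix.inv_eq_left_inv ?_
    have h := congrArg (fun M : Matrix (Fin 2) (Fin 2) ℚ => M.map (Rat.castHom ℝ : ℚ →+* ℝ)) hinvmul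
    simp only [Matrix.map_mul] at h
    rw [Matrix.map_one _ (map_zero _) (map_one _)] at h
    exact h
  have hP's : (P⁻¹).IsSymm := hPs.inv
  have hP'pos : ((P⁻¹).map (Rat.cast : ℚ → ℝ)).PosDef := by rw [hmapinv]; exact hPpos.inv
  obtain ⟨Λ, hΛ⟩ := fderiv_line_inv hPs hPpos hP's hP'pos hinvmul (fun i => (b i : ℂ))
    (-(fun i => (a i : ℂ)))
  -- the target generator
  have hmem : (fun τ : ℍ => fderiv ℂ (riemannThetaChar (fun i => ((b i : ℚ) : ℂ))
      (fun i => ((-a i : ℚ) : ℂ)) ((τ : ℂ) • (P⁻¹).map (Rat.cast : ℚ → ℂ))) 0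
      ((P⁻¹).map (Rat.cast : ℚ → ℂ) *ᵥ u)) ∈
      Submodule.span ℂ {F : ℍ → ℂ | ∃ (P : Matrix (Fin 2) (Fin 2) ℚ), P.IsSymm ∧
        (P.map (Rat.cast : ℚ → ℝ)).PosDef ∧ ∃ (a b : Fin 2 → ℚ) (u : Fin 2 → ℂ), F = fun τ : ℍ =>
          fderiv ℂ (riemannThetaChar (fun i => (a i : ℂ)) (fun i => (b i : ℂ))
            ((τ : ℂ) • P.map (Rat.cast : ℚ → ℂ))) 0 u} :=
    Submodule.subset_span ⟨P⁻¹, hP's, hP'pos, b, fun i => -a i, _, rfl⟩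
  have heq : ((fun τ : ℍ => fderiv ℂ (riemannThetaChar (fun i => (a i : ℂ)) (fun i => (b i : ℂ))
        ((τ : ℂ) • P.map (Rat.cast : ℚ → ℂ))) 0 u) ∣[(2 : ℤ)] ModularGroup.S) =
      Λ • fun τ : ℍ => fderiv ℂ (riemannThetaChar (fun i => ((b i : ℚ) : ℂ))
        (fun i => ((-a i : ℚ) : ℂ)) ((τ : ℂ) • (P⁻¹).map (Rat.cast : ℚ → ℂ))) 0
        ((P⁻¹).map (Rat.cast : ℚ → ℂ) *ᵥ u) := by
    funext τ
    rw [ModularForm.SL_slash_apply, ModularGroup.denom_S, Pi.smul_apply, smul_eq_mul]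
    have hτ0 : (τ : ℂ) ≠ 0 := UpperHalfPlane.ne_zero τ
    have hcoe : ((ModularGroup.S • τ : ℍ) : ℂ) = -((τ : ℂ)⁻¹) := by
      rw [UpperHalfPlane.modular_S_smul]; simp [inv_neg]
    simp only [hcoe]
    have hneg : (fun i => ((-a i : ℚ) : ℂ)) = -(fun i => (a i : ℂ)) := by
      funext i; push_cast; rfl
    have h := hΛ τ u
    rw [neg_neg] at h
    rw [h, hneg, _root_.zpow_neg, zpow_two]
    field_simp
  rw [heq]
  exact Submodule.smul_mem _ _ hmem


/-! ### The translations `T^j` -/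

/-- **`𝒮(τ + j) ⊆ span 𝒮`** (`j ∈ ℤ`): by level raising with `n = 2N` (`N P` integral) the period
matrix becomes `n²(τ + j)P = τ·(n²P) + S` with `S = j n² P` integral symmetric with even diagonal,
and `ϑ[a'; b'](w, τ·n²P + S) = e(-πi ᵗa'Sa') ϑ[a'; b' + Sa'](w, τ·n²P)`. -/
theorem vadd_mem_span {P : Matrix (Fin 2) (Fin 2) ℚ} (hPs : P.IsSymm)
    (hPpos : (P.map (Rat.cast : ℚ → ℝ)).PosDef) (a b : Fin 2 → ℚ) (u : Fin 2 → ℂ) (j : ℤ) :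
    (fun τ : ℍ => fderiv ℂ (riemannThetaChar (fun i => (a i : ℂ)) (fun i => (b i : ℂ))
        ((((j : ℝ) +ᵥ τ : ℍ) : ℂ) • P.map (Rat.cast : ℚ → ℂ))) 0 u) ∈
      Submodule.span ℂ {F : ℍ → ℂ | ∃ (P : Matrix (Fin 2) (Fin 2) ℚ), P.IsSymm ∧
        (P.map (Rat.cast : ℚ → ℝ)).PosDef ∧ ∃ (a b : Fin 2 → ℚ) (u : Fin 2 → ℂ), F = fun τ : ℍ =>
          fderiv ℂ (riemannThetaChar (fun i => (a i : ℂ)) (fun i => (b i : ℂ))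
            ((τ : ℂ) • P.map (Rat.cast : ℚ → ℂ))) 0 u} := by
  obtain ⟨N, Z, hN, hZs, hZ⟩ := exists_intMatrix_eq_smul P hPs
  have hZentry : ∀ k l, ((Z k l : ℤ) : ℚ) = (N : ℚ) * P k l := fun k l => by
    have := congrArg (fun M : Matrix (Fin 2) (Fin 2) ℚ => M k l) hZ
    simpa [Matrix.map_apply, Matrix.smul_apply] using this
  set n : ℕ := 2 * N with hn
  have hnpos : 0 < n := by omega
  have hn0 : (n : ℂ) ≠ 0 := by exact_mod_cast hnpos.ne'
  -- the integral shift `S = j n² P`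
  set S : Matrix (Fin 2) (Fin 2) ℤ := (4 * j * (N : ℤ)) • Z with hSdef
  have hSs : S.IsSymm := hZs.smul _
  have hSeven : ∀ k, Even (S k k) := fun k =>
    ⟨2 * j * N * Z k k, by simp only [hSdef, Matrix.smul_apply, smul_eq_mul]; ring⟩
  have hSℂ : S.map ((↑) : ℤ → ℂ) = ((j : ℂ) * (n : ℂ) ^ 2) • P.map (Rat.cast : ℚ → ℂ) := by
    ext k l
    simp only [Matrix.map_apply, Matrix.smul_apply, smul_eq_mul, hSdef, hn]
    have h := hZentry k l
    have h' : ((Z k l : ℤ) : ℂ) = (N : ℂ) * ((P k l : ℚ) : ℂ) := by exact_mod_cast h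
    push_cast
    rw [h']
    ring
  -- the new line matrix `n² P`
  set P'' : Matrix (Fin 2) (Fin 2) ℚ := ((n : ℚ) ^ 2) • P with hP''
  have hP''s : P''.IsSymm := hPs.smul _
  have hP''pos : (P''.map (Rat.cast : ℚ → ℝ)).PosDef := by
    have : P''.map (Rat.cast : ℚ → ℝ) = ((n : ℝ) ^ 2) • P.map (Rat.cast : ℚ → ℝ) := by
      ext k l; simp [hP'', Matrix.smul_apply]
    rw [this]
    exact hPpos.smul (by positivity)
  have hP''c : P''.map (Rat.cast : ℚ → ℂ) = ((n : ℂ) ^ 2) • P.map (Rat.cast : ℚ → ℂ) := by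
    ext k l; simp [hP'', Matrix.smul_apply]
  -- the new characteristics
  set a' : (Fin 2 → Fin n) → Fin 2 → ℚ := fun m₀ i => (((m₀ i : ℕ) : ℚ) + a i) / n with ha'
  set b' : (Fin 2 → Fin n) → Fin 2 → ℚ := fun m₀ =>
    (fun i => (n : ℚ) * b i) + S.map ((↑) : ℤ → ℚ) *ᵥ a' m₀ with hb'
  have ha'c : ∀ m₀, (fun i => ((a' m₀ i : ℚ) : ℂ)) = fun i => ((((m₀ i : ℕ) : ℂ)) + (a i : ℂ)) / n := by
    intro m₀; funext i; simp only [ha']; push_cast; ring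
  have hb'c : ∀ m₀, (fun i => ((b' m₀ i : ℚ) : ℂ)) =
      (n : ℂ) • (fun i => (b i : ℂ)) + S.map ((↑) : ℤ → ℂ) *ᵥ fun i => ((a' m₀ i : ℚ) : ℂ) := by
    intro m₀; funext i
    simp only [hb', Pi.add_apply, Pi.smul_apply, smul_eq_mul, Matrix.mulVec, dotProduct,
      Fin.sum_univ_two, Matrix.map_apply]
    push_cast
    ring
  -- the phases
  set c' : (Fin 2 → Fin n) → ℂ := fun m₀ =>
    cexp (-(π * I * ((fun i => ((a' m₀ i : ℚ) : ℂ)) ⬝ᵥ (S.map ((↑) : ℤ → ℂ) *ᵥ fun i => ((a' m₀ i : ℚ) : ℂ)))))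
    with hc'
  -- the generators in the decomposition
  have hmem : ∀ m₀, (fun τ : ℍ => fderiv ℂ (riemannThetaChar (fun i => ((a' m₀ i : ℚ) : ℂ))
      (fun i => ((b' m₀ i : ℚ) : ℂ)) ((τ : ℂ) • P''.map (Rat.cast : ℚ → ℂ))) 0 u) ∈
      Submodule.span ℂ {F : ℍ → ℂ | ∃ (P : Matrix (Fin 2) (Fin 2) ℚ), P.IsSymm ∧
        (P.map (Rat.cast : ℚ → ℝ)).PosDef ∧ ∃ (a b : Fin 2 → ℚ) (u : Fin 2 → ℂ), F = fun τ : ℍ =>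
          fderiv ℂ (riemannThetaChar (fun i => (a i : ℂ)) (fun i => (b i : ℂ))
            ((τ : ℂ) • P.map (Rat.cast : ℚ → ℂ))) 0 u} :=
    fun m₀ => Submodule.subset_span ⟨P'', hP''s, hP''pos, a' m₀, b' m₀, u, rfl⟩
  -- the pointwise decomposition
  have hdecomp : (fun τ : ℍ => fderiv ℂ (riemannThetaChar (fun i => (a i : ℂ)) (fun i => (b i : ℂ))
        ((((j : ℝ) +ᵥ τ : ℍ) : ℂ) • P.map (Rat.cast : ℚ → ℂ))) 0 u) =
      ∑ m₀ : Fin 2 → Fin n, (c' m₀ * n) • fun τ : ℍ => fderiv ℂ (riemannThetaChar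
        (fun i => ((a' m₀ i : ℚ) : ℂ)) (fun i => ((b' m₀ i : ℚ) : ℂ))
        ((τ : ℂ) • P''.map (Rat.cast : ℚ → ℂ))) 0 u := by
    funext τ
    simp only [Finset.sum_apply, Pi.smul_apply, smul_eq_mul]
    set τ' : ℂ := (((j : ℝ) +ᵥ τ : ℍ) : ℂ) with hτ'
    have hτ'im : 0 < τ'.im := ((j : ℝ) +ᵥ τ).im_pos
    have hτ'eq : τ' = (τ : ℂ) + j := by rw [hτ', UpperHalfPlane.coe_vadd]; push_cast; ring
    obtain ⟨hsym, c₀, hc₀, hY₀⟩ := line_hyps hPs hPpos hτ'im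
    -- level raising and the shift, as an identity of functions of `z`
    have hsplit : ∀ m₀ : Fin 2 → Fin n,
        ((n : ℂ) ^ 2) • (τ' • P.map (Rat.cast : ℚ → ℂ)) =
          (τ : ℂ) • P''.map (Rat.cast : ℚ → ℂ) + S.map ((↑) : ℤ → ℂ) := by
      intro _
      rw [hP''c, hSℂ, smul_smul, smul_smul, ← add_smul, hτ'eq]
      congr 1; ring
    have hfun : riemannThetaChar (fun i => (a i : ℂ)) (fun i => (b i : ℂ)) (τ' • P.map (Rat.cast : ℚ → ℂ)) =
        fun z => ∑ m₀ : Fin 2 → Fin n, c' m₀ *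
          riemannThetaChar (fun i => ((a' m₀ i : ℚ) : ℂ)) (fun i => ((b' m₀ i : ℚ) : ℂ))
            ((τ : ℂ) • P''.map (Rat.cast : ℚ → ℂ)) ((n : ℂ) • z) := by
      funext z
      rw [riemannThetaChar_eq_sum_level _ hsym hc₀ hY₀ _ _ z hnpos]
      refine Finset.sum_congr rfl fun m₀ _ => ?_
      rw [hsplit m₀, ← ha'c m₀, riemannThetaChar_add_intSymm hSs (hSeven 0) (hSeven 1), ← hb'c m₀]
    -- differentiate at `0`
    have hτim : 0 < (τ : ℂ).im := τ.im_pos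
    obtain ⟨hsym'', c₁, hc₁, hY₁⟩ := line_hyps hP''s hP''pos hτim
    have hderiv : ∀ m₀ : Fin 2 → Fin n, HasFDerivAt (fun z : Fin 2 → ℂ => c' m₀ *
        riemannThetaChar (fun i => ((a' m₀ i : ℚ) : ℂ)) (fun i => ((b' m₀ i : ℚ) : ℂ))
          ((τ : ℂ) • P''.map (Rat.cast : ℚ → ℂ)) ((n : ℂ) • z))
        (c' m₀ • ((fderiv ℂ (riemannThetaChar (fun i => ((a' m₀ i : ℚ) : ℂ)) (fun i => ((b' m₀ i : ℚ) : ℂ))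
          ((τ : ℂ) • P''.map (Rat.cast : ℚ → ℂ))) 0).comp ((n : ℂ) • ContinuousLinearMap.id ℂ (Fin 2 → ℂ)))) 0 := by
      intro m₀
      have hd := (differentiable_riemannThetaChar _ hsym'' hc₁ hY₁ (fun i => ((a' m₀ i : ℚ) : ℂ))
        (fun i => ((b' m₀ i : ℚ) : ℂ))).differentiableAt (x := (n : ℂ) • (0 : Fin 2 → ℂ))
      have h1 : HasFDerivAt (fun z : Fin 2 → ℂ => (n : ℂ) • z) ((n : ℂ) • ContinuousLinearMap.id ℂ (Fin 2 → ℂ)) 0 :=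
        (ContinuousLinearMap.id ℂ (Fin 2 → ℂ)).hasFDerivAt.const_smul (n : ℂ)
      have h2 := hd.hasFDerivAt.comp (0 : Fin 2 → ℂ) h1
      rw [smul_zero] at h2
      exact h2.const_mul (c' m₀)
    have hsum := HasFDerivAt.fun_sum (u := Finset.univ) fun m₀ _ => hderiv m₀
    have hsum' : HasFDerivAt (riemannThetaChar (fun i => (a i : ℂ)) (fun i => (b i : ℂ))
        (τ' • P.map (Rat.cast : ℚ → ℂ))) (∑ m₀ : Fin 2 → Fin n, c' m₀ •
          ((fderiv ℂ (riemannThetaChar (fun i => ((a' m₀ i : ℚ) : ℂ)) (fun i => ((b' m₀ i : ℚ) : ℂ))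
            ((τ : ℂ) • P''.map (Rat.cast : ℚ → ℂ))) 0).comp ((n : ℂ) • ContinuousLinearMap.id ℂ (Fin 2 → ℂ)))) 0 := by
      rw [hfun]; exact hsum
    rw [hsum'.fderiv]
    simp only [FunLike.coe_sum, Finset.sum_apply, FunLike.coe_smul,
      Pi.smul_apply, ContinuousLinearMap.comp_apply, ContinuousLinearMap.id_apply,
      ContinuousLinearMap.map_smul, smul_eq_mul]
    refine Finset.sum_congr rfl fun m₀ _ => ?_
    ring
  rw [hdecomp]
  exact Submodule.sum_mem _ fun m₀ _ => Submodule.smul_mem _ _ (hmem m₀)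


/-- **`span 𝒮 ∣[2] T^j ⊆ span 𝒮`.** -/
theorem slash_T_zpow_mem_span (j : ℤ) {F : ℍ → ℂ}
    (hF : F ∈ Submodule.span ℂ {F : ℍ → ℂ | ∃ (P : Matrix (Fin 2) (Fin 2) ℚ), P.IsSymm ∧
        (P.map (Rat.cast : ℚ → ℝ)).PosDef ∧ ∃ (a b : Fin 2 → ℚ) (u : Fin 2 → ℂ), F = fun τ : ℍ =>
          fderiv ℂ (riemannThetaChar (fun i => (a i : ℂ)) (fun i => (b i : ℂ))
            ((τ : ℂ) • P.map (Rat.cast : ℚ → ℂ))) 0 u}) :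
    (F ∣[(2 : ℤ)] (ModularGroup.T ^ j)) ∈ Submodule.span ℂ {F : ℍ → ℂ | ∃ (P : Matrix (Fin 2) (Fin 2) ℚ),
        P.IsSymm ∧ (P.map (Rat.cast : ℚ → ℝ)).PosDef ∧ ∃ (a b : Fin 2 → ℚ) (u : Fin 2 → ℂ), F = fun τ : ℍ =>
          fderiv ℂ (riemannThetaChar (fun i => (a i : ℂ)) (fun i => (b i : ℂ))
            ((τ : ℂ) • P.map (Rat.cast : ℚ → ℂ))) 0 u} := by
  have hslash : ∀ G : ℍ → ℂ, (G ∣[(2 : ℤ)] (ModularGroup.T ^ j)) = fun τ => G ((j : ℝ) +ᵥ τ) := by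
    intro G
    funext τ
    rw [ModularForm.SL_slash_apply, ModularGroup.denom_apply, UpperHalfPlane.modular_T_zpow_smul,
      ModularGroup.coe_T_zpow]
    simp
  induction hF using Submodule.span_induction with
  | mem G hG =>
    obtain ⟨P, hPs, hPpos, a, b, u, rfl⟩ := hG
    rw [hslash]
    exact vadd_mem_span hPs hPpos a b u j
  | zero => rw [SlashAction.zero_slash]; exact Submodule.zero_mem _
  | add G G' _ _ hG hG' => rw [SlashAction.add_slash]; exact Submodule.add_mem _ hG hG'
  | smul c G _ hG => rw [ModularForm.SL_smul_slash]; exact Submodule.smul_mem _ _ hG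

/-- **`span 𝒮 ∣[2] S ⊆ span 𝒮`.** -/
theorem slash_S_mem_span' {F : ℍ → ℂ}
    (hF : F ∈ Submodule.span ℂ {F : ℍ → ℂ | ∃ (P : Matrix (Fin 2) (Fin 2) ℚ), P.IsSymm ∧
        (P.map (Rat.cast : ℚ → ℝ)).PosDef ∧ ∃ (a b : Fin 2 → ℚ) (u : Fin 2 → ℂ), F = fun τ : ℍ =>
          fderiv ℂ (riemannThetaChar (fun i => (a i : ℂ)) (fun i => (b i : ℂ))
            ((τ : ℂ) • P.map (Rat.cast : ℚ → ℂ))) 0 u}) :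
    (F ∣[(2 : ℤ)] ModularGroup.S) ∈ Submodule.span ℂ {F : ℍ → ℂ | ∃ (P : Matrix (Fin 2) (Fin 2) ℚ),
        P.IsSymm ∧ (P.map (Rat.cast : ℚ → ℝ)).PosDef ∧ ∃ (a b : Fin 2 → ℚ) (u : Fin 2 → ℂ), F = fun τ : ℍ =>
          fderiv ℂ (riemannThetaChar (fun i => (a i : ℂ)) (fun i => (b i : ℂ))
            ((τ : ℂ) • P.map (Rat.cast : ℚ → ℂ))) 0 u} := by
  induction hF using Submodule.span_induction with
  | mem G hG =>
    obtain ⟨P, hPs, hPpos, a, b, u, rfl⟩ := hG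
    exact slash_S_mem_span hPs hPpos a b u
  | zero => rw [SlashAction.zero_slash]; exact Submodule.zero_mem _
  | add G G' _ _ hG hG' => rw [SlashAction.add_slash]; exact Submodule.add_mem _ hG hG'
  | smul c G _ hG => rw [ModularForm.SL_smul_slash]; exact Submodule.smul_mem _ _ hG

/-- **The span is stable under `SL₂(ℤ)` in weight two.** -/
theorem slash_mem_span (γ : SL(2, ℤ)) {F : ℍ → ℂ}
    (hF : F ∈ Submodule.span ℂ {F : ℍ → ℂ | ∃ (P : Matrix (Fin 2) (Fin 2) ℚ), P.IsSymm ∧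
        (P.map (Rat.cast : ℚ → ℝ)).PosDef ∧ ∃ (a b : Fin 2 → ℚ) (u : Fin 2 → ℂ), F = fun τ : ℍ =>
          fderiv ℂ (riemannThetaChar (fun i => (a i : ℂ)) (fun i => (b i : ℂ))
            ((τ : ℂ) • P.map (Rat.cast : ℚ → ℂ))) 0 u}) :
    (F ∣[(2 : ℤ)] γ) ∈ Submodule.span ℂ {F : ℍ → ℂ | ∃ (P : Matrix (Fin 2) (Fin 2) ℚ),
        P.IsSymm ∧ (P.map (Rat.cast : ℚ → ℝ)).PosDef ∧ ∃ (a b : Fin 2 → ℚ) (u : Fin 2 → ℂ), F = fun τ : ℍ =>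
          fderiv ℂ (riemannThetaChar (fun i => (a i : ℂ)) (fun i => (b i : ℂ))
            ((τ : ℂ) • P.map (Rat.cast : ℚ → ℂ))) 0 u} := by
  have hγ : γ ∈ Subgroup.closure {ModularGroup.S, ModularGroup.T} := by
    rw [SpecialLinearGroup.SL2Z_generators]; trivial
  induction hγ using Subgroup.closure_induction'' generalizing F with
  | one => rw [SlashAction.slash_one]; exact hF
  | mem g hg =>
    simp only [Set.mem_insert_iff, Set.mem_singleton_iff] at hg
    rcases hg with rfl | rfl
    · exact slash_S_mem_span' hF
    · have := slash_T_zpow_mem_span 1 hF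
      rwa [zpow_one] at this
  | inv_mem g hg =>
    simp only [Set.mem_insert_iff, Set.mem_singleton_iff] at hg
    rcases hg with rfl | rfl
    · have hS : ModularGroup.S⁻¹ = ModularGroup.S * ModularGroup.S * ModularGroup.S := by
        ext i j
        fin_cases i <;> fin_cases j <;> simp [ModularGroup.S]
      rw [hS, SlashAction.slash_mul, SlashAction.slash_mul]
      exact slash_S_mem_span' (slash_S_mem_span' (slash_S_mem_span' hF))
    · have := slash_T_zpow_mem_span (-1) hF
      rwa [_root_.zpow_neg_one] at this
  | mul g g' _ _ ihg ihg' =>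
    rw [SlashAction.slash_mul]
    exact ihg' (ihg hF)

/-! ### Decay and holomorphy on the span -/

/-- Every function in the span tends to `0` at `i∞`. -/
theorem isZeroAtImInfty_of_mem_span {F : ℍ → ℂ}
    (hF : F ∈ Submodule.span ℂ {F : ℍ → ℂ | ∃ (P : Matrix (Fin 2) (Fin 2) ℚ), P.IsSymm ∧
        (P.map (Rat.cast : ℚ → ℝ)).PosDef ∧ ∃ (a b : Fin 2 → ℚ) (u : Fin 2 → ℂ), F = fun τ : ℍ =>
          fderiv ℂ (riemannThetaChar (fun i => (a i : ℂ)) (fun i => (b i : ℂ))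
            ((τ : ℂ) • P.map (Rat.cast : ℚ → ℂ))) 0 u}) :
    UpperHalfPlane.IsZeroAtImInfty F := by
  induction hF using Submodule.span_induction with
  | mem G hG =>
    obtain ⟨P, hPs, hPpos, a, b, u, rfl⟩ := hG
    exact isZeroAtImInfty_fderiv_line hPs hPpos a b u
  | zero => exact (UpperHalfPlane.zeroAtImInftySubmodule ℂ).zero_mem
  | add G G' _ _ hG hG' => exact (UpperHalfPlane.zeroAtImInftySubmodule ℂ).add_mem hG hG'
  | smul c G _ hG => exact (UpperHalfPlane.zeroAtImInftySubmodule ℂ).smul_mem c hG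

/-- Every function in the span is holomorphic on `ℍ`. -/
theorem mdifferentiable_of_mem_span {F : ℍ → ℂ}
    (hF : F ∈ Submodule.span ℂ {F : ℍ → ℂ | ∃ (P : Matrix (Fin 2) (Fin 2) ℚ), P.IsSymm ∧
        (P.map (Rat.cast : ℚ → ℝ)).PosDef ∧ ∃ (a b : Fin 2 → ℚ) (u : Fin 2 → ℂ), F = fun τ : ℍ =>
          fderiv ℂ (riemannThetaChar (fun i => (a i : ℂ)) (fun i => (b i : ℂ))
            ((τ : ℂ) • P.map (Rat.cast : ℚ → ℂ))) 0 u}) :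
    MDifferentiable 𝓘(ℂ) 𝓘(ℂ) F := by
  induction hF using Submodule.span_induction with
  | mem G hG =>
    obtain ⟨P, hPs, hPpos, a, b, u, rfl⟩ := hG
    exact mdifferentiable_fderiv_line hPs hPpos a b u
  | zero => exact mdifferentiable_const
  | add G G' _ _ hG hG' => exact hG.add hG'
  | smul c G _ hG => exact hG.const_smul c

end Summit.BirchSwinnertonDyer.BirchSwinnertonDyer.Theorems.HeckeTheta

end
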